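import Literature.MathematicalPhysics.QuantumFieldTheory.BalabanImbrieJaffe1984to88.BIJ88TermHitShellBound309
import Literature.MathematicalPhysics.QuantumFieldTheory.BalabanImbrieJaffe1984to88.BIJ88ActivityWalkBound309

/-!
# `BalabanImbrieJaffe1984to88.BIJ88LocatedActivityBound309` — T. Bałaban, J. Imbrie, A. Jaffe, *Effective action and cluster properties of the
abelian Higgs model*, Commun. Math. Phys. **114** (1988) 257–315 [BalabanImbrieJaffe1988]: p. 307 [PDF 51] L2–20 (Sect. 5.13, the estimate of
`g₂`: *"Each time some □_j's are joined, we have s-derivatives, which produce functional derivatives, chains of covariances C_ω(α), and factors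
ℱ = O(e^{−cr(e_k)}). Functional derivatives hitting χ-factors … produce factors e^{−cp(e_k)²} … Functional derivatives hitting e^{−V^{(k)}(Y)}
yield factors e^β(L^kε/ε₀)^{1/4−α}. … Altogether we have small factors at each end of C_ω(α) … If the walk ω(α) wanders through more than a few
cubes, we begin to pickup factors e^{−cr(e_k)}. These control the sum over walks and partitions, and the factorials, as in [9]."*) and p. 309
[PDF 53] L12–28 ((5.14.4) and its proof sketch: *"The proof of this estimate is similar to the one for g₂. … Each t-derivative of a χ-factor in
χ′_{Λ₁₂^{(k)},t} gives at least a factor e^β(L^kε/ε₀)^{1/4−α} … After integration over A^{(k)}, we obtain factors ct^{−n}e^{−cp(te_k)²}"*) —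
**THE MASTER BOUND OF THE LOCATED ACTIVITY `g₃(H, X″)`, `|X″| ≥ 2`: A SUM OVER VERTEX STRUCTURES, TRAINS, END DATA AND SLOT ASSIGNMENTS OF
(CERTIFIED TRAIN-END SIZES) × (SLOT LETTERS OF THE LEGS) × (ONE GAUSSIAN SHELL FACTOR PER HIT χ-SLOT)**.

The §f assembly of this lineage COMPOSED for the located derivative observables `fD_H(□_i)` of p. 308: layer E4b
(`BIJ88ActivityWalkBound309.abs_actIn_le_sum`: the activity is a sum over `σ ∈ smallParts X″`, `P ∈ setPartitions σ` of cube-uniform bounds on the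
train expectations), layer E4c in its sharp form (`BIJ88TermHitShellBound309.abs_gexp_trains_obs_le_hit`: one train expectation ≤ Σ over end data
`E` and slot assignments `g` of `|trainCoef_E|` × slot letters × a shell factor for EVERY χ-slot hit by `t` or by a leg) and the train-coefficient
step of E4d (`BIJ88TrainTermBound307.abs_trainCoef_le`: `|trainCoef_E| ≤ Π_k [Σ_q κ_{c_k}(p_k,q)F_q | ½κ_{c_k}(p_k,q_k)]` from entrywise walk-kernel
certificates):
* §1 `abs_gexp_trains_fD_uD_le_of_cert` — one train expectation at fixed `s` with certified end sizes;
* §2 **`abs_actIn_le_master`** — THE MASTER BOUND: for `|X″| ≥ 2` the prime-dropped located activity `actIn … H X″` of the leaf `h5144three`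
  (coupling `Δ_{1_Λ}`, slot data re-indexed to the region `X`, `BIJ88W6PrimeVsupp.actIn`) is at most
  `Σ_{σ,P} Σ_{E,g} (Π_k certified end size) · (Π_{τ: cube τ∈X″} A_τ(m_τ, n_τ(E,g))·Π_{legs j on τ} w_τ(q_j)) · Π_{b: χ-slot of X″, m_b≠0 or n_b≠0}
  2e^{−a_b(a_b−2ΛF/m)/(2Λ²/m)}`, the certificates `κ_c` UNIFORM IN `s ∈ [0,1]^I`.
What is left for the located (5.14.4) is SIZE bookkeeping only: the decay of `κ_c` along the walk (p. 307 L14–16), the control of the sums over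
`σ, P, E, g` by the weights (p. 307 L16: *"as in [9]"*) and the `θ`-exponents.

statement-level skeleton of published theorems with citation tags; proofs where landed; nothing here is a claim about the Yang–Mills mass gap

PDF held: `paper:balaban1988-cmp114-bij-abelian-higgs-effective-action` (journal page = PDF page + 256); pages re-read this session as text:
PDF 51 (p. 307) L2–23, PDF 53 (p. 309) L10–28.

CITATION HEADER (lean-in-tree rule).  Part of the lit-balaban TYPED SKELETON (HOME `run/shared/lean/pub/lit-balaban/`), Phase 2, seat p36
(gen 22, unit `lit-balaban-p36`); rows **C2.Eq5.14.3-5.14.4** (member: §f assembly — the master bound E4b∘E4c∘E4d-coefficients) and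
C2.Eq5.13.3-5.13.4 (member) of `HOME/lit-balaban-r16/ROWS-C2-part2.md` (owner r16, referee ref-5).  Theorem-only; no definitions, no `Prop`
facts; axioms standard.
HONEST SCOPE.  An inequality with every size carried as a letter: the slot-cost families `A_τ, w_τ` (χ-slots dischargeable by
`BIJ88ChiSlotDsetBound309.exists_abs_dset_uD_inl_le` with `w_b(q) = |Φ_b(ext e_q)|`; `V`-slots = r16's typing gap #1 in all-orders form), the
walk-kernel certificates `κ_c` (their decay: `BIJ88WalkKernelDecay307`/`BIJ88WalkKeptDecay307`/`BIJ88WalkKernelSourceDecay307` at vertex level; for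
print's per-cube small factors a site-level walk estimate NOT in the tree), the frame letter `Λ` of the χ-slots of `X″`, coercivity `m`, source
bounds `F, F_q`, thresholds `a_b ≤ a′_b`; linear χ-slot fields only; a site in `X″`.  Nothing is summed or compared with `θ` here.  NOT summit
progress; NOT continuum; NOT Clay.
-/

namespace Literature.MathematicalPhysics.QuantumFieldTheory.BalabanImbrieJaffe1984to88.BIJ88LocatedActivityBound309

open Finset Matrix
open scoped BigOperators
open Literature.Probability.LatticeModels (setPartitions)
open BIJ88DirichletForms305 (interpForm)
open BIJ88PairingAllOrders5133 (smallParts)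
open BIJ88WickSourceSmooth305 (dset)
open BIJ88SmoothFactors5133 (CbInf)
open BIJ88TrainPieces306 (wker)
open BIJ88WalkForm5133 (trains)
open BIJ88TrainsDsetExpansion306 (trainCoef trainLegs trainSite)
open BIJ88TrainTermBound307 (abs_trainCoef_le)
open BIJ88TruncationConnected306 (gexp)
open BIJ88TruncationConnected5133 (bmat)
open BIJ88PolymerRep5134 (corner)
open BIJ88PolymerRep5134Gauss (obs prec src ext)
open BIJ88Sect5Statements (CutoffProfile)
open BIJ88Expansion5143Gauss (fD)
open BIJ88SlotMomentsGauss308 (uD)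
open BIJ88Eq5145CornerModel (slotB slotY)
open BIJ88Eq5145CornerUrsell (cubeIn)
open BIJ88W6PrimeVsupp (actIn)
open BIJ88TermHitShellBound309 (abs_gexp_trains_obs_le_hit)
open BIJ88ActivityWalkBound309 (abs_actIn_le_sum)

variable {α I : Type} [Fintype α] [DecidableEq α] [Fintype I] [DecidableEq I] (blk : α → I) (Δ : Matrix α α ℝ) (ℱ : α → ℝ)
variable (χ : CutoffProfile) {ι υ : Type} [DecidableEq ι] [DecidableEq υ] (p : ℝ) {ek t : ℝ} (B : Finset ι)
  {Φ : ι → (α → ℝ) → ℝ} {c : ι → ℝ} (Ys : Finset υ) {V : υ → (α → ℝ) → ℝ} (cube : ↥B ⊕ ↥Ys → I) {L : Type*} (γ : L → ↥B ⊕ ↥Ys)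

/-- a certified end size is nonnegative when both branches are. [cite: BalabanImbrieJaffe1988, §5.13 p.307] -/
theorem sum_elim_nonneg {S₁ : Type*} {f₁ : S₁ → ℝ} {f₂ : S₁ × S₁ → ℝ} (h₁ : ∀ x, 0 ≤ f₁ x) (h₂ : ∀ xy, 0 ≤ f₂ xy)
    (e : S₁ ⊕ (S₁ × S₁)) : 0 ≤ Sum.elim f₁ f₂ e := by
  cases e with
  | inl x => exact h₁ x
  | inr xy => exact h₂ xy

/-! ## §1  One train expectation of the located derivative observables with certified end sizes, fixed `s` -/

/-- **ONE TRAIN EXPECTATION WITH CERTIFIED TRAIN-END SIZES**: `BIJ88TermHitShellBound309.abs_gexp_trains_obs_le_hit` for the trains built on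
`C_s = (prec X s)⁻¹` and vertex matrices `N_b`, with the train coefficients bounded through entrywise walk-kernel certificates
`|(C_s𝔫(c))(p,q)| ≤ κ_c(p,q)` and a sitewise source letter `|ℱ_q| ≤ F_q` (`BIJ88TrainTermBound307.abs_trainCoef_le`; p. 307: *"small factors at
each end of C_ω(α)"*, *"factors ℱ = O(e^{−cr(e_k)})"*):
`|⟨(Π_k 𝕋_{c_k}) Π_{□_i⊂X} fD_H(□_i)⟩_{s,X}| ≤ Σ_E Σ_g (Π_k [Σ_q κ_{c_k}(p_k,q)F_q | ½κ_{c_k}(p_k,q_k)]) · (Π_τ A_τ(m_τ,n_τ)·Π_j w_τ(q_j)) ·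
Π_{b hit} 2e^{−a_b(a_b−2ΛF/m)/(2Λ²/m)}`. [cite: BalabanImbrieJaffe1988, §5.13 p.307, (5.14.4) p.309] -/
theorem abs_gexp_trains_fD_uD_le_of_cert (X : Finset I) (hΔ : Δ.PosDef) {m : ℝ} (hm : 0 < m)
    (hΔm : ∀ φ : α → ℝ, m * (φ ⬝ᵥ φ) ≤ φ ⬝ᵥ (Δ *ᵥ φ)) {s : I → ℝ} (hs : ∀ i, 0 ≤ s i ∧ s i ≤ 1)
    (hek : 0 < ek) (ht : 0 < t) (h1 : t * ek < 1) (hΦ : ∀ b ∈ B, IsLinearMap ℝ (Φ b)) (hc : ∀ b ∈ B, c b ≠ 0)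
    (hV : ∀ Y ∈ Ys, CbInf (V Y)) (K : Finset L) (τ₀ : ↥B ⊕ ↥Ys) {Λ : ℝ} (hΛ : 0 < Λ)
    (hframe : ∀ (θ : ↥(univ.filter fun b : ↥B => cube (Sum.inl b) ∈ X) → ℝ) (φ : α → ℝ),
      |∑ b, θ b * Φ b.1.1 φ| ≤ Λ * Real.sqrt (∑ b, θ b ^ 2) * Real.sqrt (φ ⬝ᵥ φ))
    {F : ℝ} (hF0 : 0 ≤ F) (hF : src blk ℱ X ⬝ᵥ src blk ℱ X ≤ F ^ 2) {a a' : ↥B → ℝ} (ha : ∀ b, 0 ≤ a b)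
    (N : Finset I → Matrix (BIJ88PolymerRep5134Gauss.Site blk X) (BIJ88PolymerRep5134Gauss.Site blk X) ℝ)
    (Lt : List (Finset (Finset I)))
    {A : ↥B ⊕ ↥Ys → ℕ → ℕ → ℝ} (hA : ∀ τ m n, 0 ≤ A τ m n) (hA1 : ∀ b : ↥B, 1 ≤ A (Sum.inl b) 0 0)
    {w : ↥B ⊕ ↥Ys → BIJ88PolymerRep5134Gauss.Site blk X → ℝ} (hw : ∀ τ x, 0 ≤ w τ x)
    (hχ : ∀ (q : Fin Lt.length ×ₗ Fin 2 → BIJ88PolymerRep5134Gauss.Site blk X) (b : ↥B) (m : ℕ) (D' : Finset (Fin Lt.length ×ₗ Fin 2))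
      (φ : BIJ88PolymerRep5134Gauss.Site blk X → ℝ), (m ≠ 0 ∨ D'.card ≠ 0) →
      |dset (fun j => Pi.single (q j) (1 : ℝ)) D' (fun ψ => uD χ p ek B Φ c Ys V t (Sum.inl b) m (ext blk X ψ)) φ| ≤
        A (Sum.inl b) m D'.card * (∏ j ∈ D', w (Sum.inl b) (q j)) *
          Set.indicator (Set.Icc (a b) (a' b)) (fun _ => (1 : ℝ)) |Φ b (ext blk X φ)|)
    (hY : ∀ (q : Fin Lt.length ×ₗ Fin 2 → BIJ88PolymerRep5134Gauss.Site blk X) (Y : ↥Ys) (m : ℕ) (D' : Finset (Fin Lt.length ×ₗ Fin 2))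
      (φ : BIJ88PolymerRep5134Gauss.Site blk X → ℝ),
      |dset (fun j => Pi.single (q j) (1 : ℝ)) D' (fun ψ => uD χ p ek B Φ c Ys V t (Sum.inr Y) m (ext blk X ψ)) φ| ≤
        A (Sum.inr Y) m D'.card * ∏ j ∈ D', w (Sum.inr Y) (q j))
    {κc : Finset (Finset I) → BIJ88PolymerRep5134Gauss.Site blk X → BIJ88PolymerRep5134Gauss.Site blk X → ℝ}
    (hκ : ∀ (cg : Finset (Finset I)) (x y : BIJ88PolymerRep5134Gauss.Site blk X),
      |((prec blk Δ X s)⁻¹ * wker (prec blk Δ X s)⁻¹ N cg) x y| ≤ κc cg x y)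
    {Fq : BIJ88PolymerRep5134Gauss.Site blk X → ℝ} (hFq : ∀ q : BIJ88PolymerRep5134Gauss.Site blk X, |ℱ q.1| ≤ Fq q) :
    |gexp (prec blk Δ X s) (src blk ℱ X)
        (trains (src blk ℱ X) (prec blk Δ X s)⁻¹ N Lt (obs blk (fD (uD χ p ek B Φ c Ys V t) cube γ K) X))| ≤
      ∑ E : Fin Lt.length → BIJ88PolymerRep5134Gauss.Site blk X ⊕
          (BIJ88PolymerRep5134Gauss.Site blk X × BIJ88PolymerRep5134Gauss.Site blk X),
        ∑ g ∈ Fintype.piFinset (fun j => if j ∈ trainLegs E then univ.filter (fun τ => cube τ ∈ X) else {τ₀}),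
          (∏ k, Sum.elim (fun x => ∑ y, κc (Lt.get k) x y * Fq y) (fun xy => (1 / 2 : ℝ) * κc (Lt.get k) xy.1 xy.2) (E k)) *
            (∏ τ ∈ univ.filter (fun τ => cube τ ∈ X),
              (A τ (K.filter fun j => γ j = τ).card ((trainLegs E).filter fun j => g j = τ).card *
                ∏ j ∈ (trainLegs E).filter (fun j => g j = τ), w τ (trainSite E j))) *
            ∏ b ∈ (univ.filter fun b : ↥B => cube (Sum.inl b) ∈ X).attach.filter (fun b =>
                (K.filter fun j => γ j = Sum.inl b.1).card ≠ 0 ∨ ((trainLegs E).filter fun j => g j = Sum.inl b.1).card ≠ 0),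
              2 * Real.exp (-(a b.1 * (a b.1 - 2 * (Λ * F / m)) / (2 * (Λ ^ 2 / m)))) := by
  refine (abs_gexp_trains_obs_le_hit blk Δ ℱ X χ p B Ys cube γ hΔ hm hΔm hs hek ht h1 hΦ hc hV K τ₀ hΛ hframe hF0 hF ha
    (prec blk Δ X s)⁻¹ N Lt hA hA1 hw hχ hY).trans (sum_le_sum fun E _ => sum_le_sum fun g _ =>
      mul_le_mul_of_nonneg_right (mul_le_mul_of_nonneg_right ?_ ?_) ?_)
  · exact abs_trainCoef_le (f := src blk ℱ X) (fun k x y => hκ (Lt.get k) x y) (fun q => hFq q) E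
  · exact prod_nonneg fun τ _ => mul_nonneg (hA _ _ _) (prod_nonneg fun j _ => hw _ _)
  · exact prod_nonneg fun b _ => mul_nonneg zero_le_two (Real.exp_nonneg _)

/-! ## §2  THE MASTER BOUND of the prime-dropped located activity -/

section Master

variable (adj : I → I → Prop) [DecidableRel adj] (Λc : Finset I)

/-- **THE MASTER BOUND OF `g₃(H, X″)`, `|X″| ≥ 2`, ON THE LINEAGE'S MODEL** (p. 309: *"The proof of this estimate is similar to the one for
g₂"*; p. 307 for `g₂`): the prime-dropped located activity `actIn … H X″` (coupling `Δ_{1_Λ}`, p36's slot data re-indexed to the region `X`,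
`BIJ88W6PrimeVsupp.actIn`) is at most the sum over vertex structures `σ ∈ smallParts X″`, groupings `P ∈ setPartitions σ`, end data `E` of the
trains `P.toList` and slot assignments `g` of the legs, of (certified train-end sizes, from walk-kernel certificates `κ_c` UNIFORM IN
`s ∈ [0,1]^I` and the source letter `F_q`) × (the slot letters `A_τ, w_τ` of the legs and `t`-derivatives) × (one Gaussian shell factor per χ-slot
of `X″` hit by `t` or by a leg).  Hypotheses otherwise as `BIJ88ActivityWalkBound309.abs_actIn_le_sum` and §1.
[cite: BalabanImbrieJaffe1988, (5.14.4) p.309; §5.13 p.306–307] -/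
theorem abs_actIn_le_master (hΔ : Δ.PosDef) {m C₀ : ℝ} (hm : 0 < m)
    (hΔm : ∀ φ : α → ℝ, m * (φ ⬝ᵥ φ) ≤ φ ⬝ᵥ (Δ *ᵥ φ)) (hCΔ : ∀ v, v ⬝ᵥ (Δ *ᵥ v) ≤ C₀ * (v ⬝ᵥ v))
    (hek : 0 < ek) (ht : 0 < t) (h1 : t * ek < 1) (hΦ : ∀ b ∈ B, IsLinearMap ℝ (Φ b)) (hc : ∀ b ∈ B, c b ≠ 0)
    (hV : ∀ Y ∈ Ys, CbInf (V Y))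
    (X : Finset I) {S : Type*} [DecidableEq S] (γ' : S → ↥(slotB B Ys cube X) ⊕ ↥(slotY B Ys cube X)) (H : Finset S)
    {X'' : Finset I} (h2 : 2 ≤ X''.card) (hXs : ∃ x, blk x ∈ X'') (τ₀ : ↥(slotB B Ys cube X) ⊕ ↥(slotY B Ys cube X))
    {Λ : ℝ} (hΛ : 0 < Λ)
    (hframe : ∀ (θ : ↥(univ.filter fun b : ↥(slotB B Ys cube X) => cubeIn cube X (Sum.inl b) ∈ X'') → ℝ) (φ : α → ℝ),
      |∑ b, θ b * Φ b.1.1 φ| ≤ Λ * Real.sqrt (∑ b, θ b ^ 2) * Real.sqrt (φ ⬝ᵥ φ))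
    {F : ℝ} (hF0 : 0 ≤ F) (hF : src blk ℱ X'' ⬝ᵥ src blk ℱ X'' ≤ F ^ 2) {a a' : ↥(slotB B Ys cube X) → ℝ} (ha : ∀ b, 0 ≤ a b)
    {A : ↥(slotB B Ys cube X) ⊕ ↥(slotY B Ys cube X) → ℕ → ℕ → ℝ} (hA : ∀ τ m n, 0 ≤ A τ m n)
    (hA1 : ∀ b : ↥(slotB B Ys cube X), 1 ≤ A (Sum.inl b) 0 0)
    {w : ↥(slotB B Ys cube X) ⊕ ↥(slotY B Ys cube X) → BIJ88PolymerRep5134Gauss.Site blk X'' → ℝ} (hw : ∀ τ x, 0 ≤ w τ x)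
    (hχ : ∀ (κ : Type) [LinearOrder κ] (q : κ → BIJ88PolymerRep5134Gauss.Site blk X'') (b : ↥(slotB B Ys cube X)) (m : ℕ)
      (D' : Finset κ) (φ : BIJ88PolymerRep5134Gauss.Site blk X'' → ℝ), (m ≠ 0 ∨ D'.card ≠ 0) →
      |dset (fun j => Pi.single (q j) (1 : ℝ)) D'
        (fun ψ => uD χ p ek (slotB B Ys cube X) (fun b : ↥B => Φ b) (fun b : ↥B => c b) (slotY B Ys cube X) (fun Y : ↥Ys => V Y) t
          (Sum.inl b) m (ext blk X'' ψ)) φ| ≤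
        A (Sum.inl b) m D'.card * (∏ j ∈ D', w (Sum.inl b) (q j)) *
          Set.indicator (Set.Icc (a b) (a' b)) (fun _ => (1 : ℝ)) |Φ b.1 (ext blk X'' φ)|)
    (hY : ∀ (κ : Type) [LinearOrder κ] (q : κ → BIJ88PolymerRep5134Gauss.Site blk X'') (Y : ↥(slotY B Ys cube X)) (m : ℕ)
      (D' : Finset κ) (φ : BIJ88PolymerRep5134Gauss.Site blk X'' → ℝ),
      |dset (fun j => Pi.single (q j) (1 : ℝ)) D'
        (fun ψ => uD χ p ek (slotB B Ys cube X) (fun b : ↥B => Φ b) (fun b : ↥B => c b) (slotY B Ys cube X) (fun Y : ↥Ys => V Y) t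
          (Sum.inr Y) m (ext blk X'' ψ)) φ| ≤
        A (Sum.inr Y) m D'.card * ∏ j ∈ D', w (Sum.inr Y) (q j))
    {κc : Finset (Finset I) → BIJ88PolymerRep5134Gauss.Site blk X'' → BIJ88PolymerRep5134Gauss.Site blk X'' → ℝ}
    (hκ : ∀ s : I → ℝ, (∀ i, 0 ≤ s i ∧ s i ≤ 1) → ∀ (cg : Finset (Finset I)) (x y : BIJ88PolymerRep5134Gauss.Site blk X''),
      |((prec blk (interpForm blk Δ (corner ℝ Λc)) X'' s)⁻¹ *
          wker (prec blk (interpForm blk Δ (corner ℝ Λc)) X'' s)⁻¹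
            (fun b => bmat (fun x : BIJ88PolymerRep5134Gauss.Site blk X'' => blk x.1)
                ((interpForm blk Δ (corner ℝ Λc)).submatrix Subtype.val Subtype.val) s b
              + (bmat (fun x : BIJ88PolymerRep5134Gauss.Site blk X'' => blk x.1)
                ((interpForm blk Δ (corner ℝ Λc)).submatrix Subtype.val Subtype.val) s b)ᵀ) cg) x y| ≤ κc cg x y)
    {Fq : BIJ88PolymerRep5134Gauss.Site blk X'' → ℝ} (hFq : ∀ q : BIJ88PolymerRep5134Gauss.Site blk X'', |ℱ q.1| ≤ Fq q) :
    |actIn blk Δ ℱ adj χ p ek B Φ c Ys V cube Λc X t γ' H X''| ≤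
      ∑ σ ∈ smallParts X'', ∑ P ∈ setPartitions σ,
        ∑ E : Fin P.toList.length → BIJ88PolymerRep5134Gauss.Site blk X'' ⊕
            (BIJ88PolymerRep5134Gauss.Site blk X'' × BIJ88PolymerRep5134Gauss.Site blk X''),
          ∑ g ∈ Fintype.piFinset (fun j => if j ∈ trainLegs E then univ.filter (fun τ => cubeIn cube X τ ∈ X'') else {τ₀}),
            (∏ k, Sum.elim (fun x => ∑ y, κc (P.toList.get k) x y * Fq y)
                (fun xy => (1 / 2 : ℝ) * κc (P.toList.get k) xy.1 xy.2) (E k)) *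
              (∏ τ ∈ univ.filter (fun τ => cubeIn cube X τ ∈ X''),
                (A τ (H.filter fun j => γ' j = τ).card ((trainLegs E).filter fun j => g j = τ).card *
                  ∏ j ∈ (trainLegs E).filter (fun j => g j = τ), w τ (trainSite E j))) *
              ∏ b ∈ (univ.filter fun b : ↥(slotB B Ys cube X) => cubeIn cube X (Sum.inl b) ∈ X'').attach.filter (fun b =>
                  (H.filter fun j => γ' j = Sum.inl b.1).card ≠ 0 ∨ ((trainLegs E).filter fun j => g j = Sum.inl b.1).card ≠ 0),
                2 * Real.exp (-(a b.1 * (a b.1 - 2 * (Λ * F / m)) / (2 * (Λ ^ 2 / m)))) := by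
  have hcube : ∀ i, 0 ≤ corner ℝ Λc i ∧ corner ℝ Λc i ≤ 1 := BIJ88ActivityWalkBound309.corner_mem_cube Λc
  have hΔ' : (interpForm blk Δ (corner ℝ Λc)).PosDef := BIJ88DirichletForms305.interpForm_posDef blk hΔ hcube
  have hΔm' : ∀ φ : α → ℝ, m * (φ ⬝ᵥ φ) ≤ φ ⬝ᵥ (interpForm blk Δ (corner ℝ Λc) *ᵥ φ) :=
    fun φ => BIJ88DirichletForms305.quadForm_interpForm_ge blk hΔm hcube φ
  have hκ0 : ∀ cg x y, 0 ≤ κc cg x y := fun cg x y =>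
    (abs_nonneg _).trans (hκ (fun _ => 0) (fun _ => ⟨le_rfl, zero_le_one⟩) cg x y)
  have hFq0 : ∀ y, 0 ≤ Fq y := fun y => (abs_nonneg _).trans (hFq y)
  refine abs_actIn_le_sum blk Δ ℱ adj χ cube Λc hΔ hm hΔm hCΔ hek ht h1 hΦ hc hV X γ' H h2 hXs
    (fun σ _ P _ => sum_nonneg fun E _ => sum_nonneg fun g _ => mul_nonneg (mul_nonneg
      (prod_nonneg fun k _ => sum_elim_nonneg (fun x => sum_nonneg fun y _ => mul_nonneg (hκ0 _ x y) (hFq0 y))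
        (fun xy => mul_nonneg (by norm_num) (hκ0 _ _ _)) (E k))
      (prod_nonneg fun τ _ => mul_nonneg (hA _ _ _) (prod_nonneg fun j _ => hw _ _)))
      (prod_nonneg fun b _ => mul_nonneg zero_le_two (Real.exp_nonneg _)))
    fun s hs σ _ P _ => ?_
  exact abs_gexp_trains_fD_uD_le_of_cert blk (interpForm blk Δ (corner ℝ Λc)) ℱ χ p (slotB B Ys cube X) (slotY B Ys cube X)
    (cubeIn cube X) γ' X'' hΔ' hm hΔm' hs hek ht h1 (fun b _ => hΦ b.1 b.2) (fun b _ => hc b.1 b.2) (fun Y _ => hV Y.1 Y.2)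
    H τ₀ hΛ hframe hF0 hF ha _ P.toList hA hA1 hw (fun q b m D' φ hmn => hχ _ q b m D' φ hmn) (fun q Y m D' φ => hY _ q Y m D' φ)
    (hκ s hs) hFq

end Master

end Literature.MathematicalPhysics.QuantumFieldTheory.BalabanImbrieJaffe1984to88.BIJ88LocatedActivityBound309
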